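import Summits.BirchSwinnertonDyer.Rank1Residual.X10.MuZeroRoadThree
import Summits.BirchSwinnertonDyer.BirchSwinnertonDyer.Theorems.Rank1ResidualX10bMuTransfer
import Summits.BirchSwinnertonDyer.BirchSwinnertonDyer.Theorems.Rank1ResidualX10bMainConjecture
import HarnessLib

/-!
# Class X10 ∩ {r = 1} at `p = 3` (X10a′ AND X10b = N2), EITHER mod-`3` image: `KatoMuTransferThree` ∧ one
# unit coefficient of `L_3(f, α)` ⟹ the integral divisibility, the Euler-system half (modulo Schneider)
# and `BSD(E,3)` at the `3 ∤ #Ш_an` pairs — with NO image hypothesis, so that per-pair use needs no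
# `¬surj(3)` certificate (cell `b2b-bsdres`, unit `b2b-bsdres-x10` = N2 class lead, GEN 35; TOOL —
# theorems only, no definition, no named fact, nothing booked)

HONEST FRAMING (run/shared/lean/b2b/bsd-rank1-residual/, verbatim in every file): the goal of the
cell is to DELETE the COMBINATION-SHAPED residual classes of the Birch–Swinnerton-Dyer formula for
ALL analytic-rank `≤ 1` elliptic curves over `ℚ` — "full BSD formula for every rank `≤ 1` curve in
class `C`" assembled STRICTLY from published theorems — so that the rank-`≤ 1` remainder becomes
exactly the CONSTRUCTION-SHAPED classes, which are TYPED (missing-input `Prop`s), NOT attempted.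
This is not "finishing BSD". Class X10b (N2) keeps its label CONSTRUCTION-SHAPED / NEEDS X_A3
(RESIDUAL-MAP §I N2); nothing is booked by this file; no census number moves.

## What (x10 GEN 35, X10-AUDIT §41; rank-`1` companion of `X10/MuTransferThreeIntModel.lean` §1)

`X10/MuTransferThreeEulerHalf.lean` (GEN 35) proved the rank-`1` flag-free statements on X10b under the
displayed hypothesis `¬ Surj W 3`, for which NO per-pair kernel certificate exists in the tree. On the
complementary branch `Surj W 3` (X10a′) the divisibility is Kato's INTEGRAL clause 17.4 (3) on the
good-ordinary tower (`X10.towerSurj_of_surj`, Wuthrich's Lemma 20 as a tree theorem; x10 GEN 5's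
`divisibility_of_kato_of_surjective_pow`), the certificate being unused. Excluded middle on the image:

* `divisibility_three_of_katoMuTransferThree_anyImage` — class X10 (any rank, EITHER image): Kato
  (`hK`; clause (3) or (2) by branch) ∧ `KatoMuTransferThree` ∧ `hcertA` ∧ `h3` ⟹ GEN 6's integral
  divisibility datum `hdiv`;
* `missingUpperBoundAt_three_rankOne_of_katoMuTransferThree_anyImage` — **class X10 ∩ {r = 1}, EITHER
  image: the Euler-system half `ord₃ #Ш(E/ℚ) ≤ ord₃ #Ш(E/ℚ)_an`** modulo the Schneider certificate;
* `bsdp_three_rankOne_of_katoMuTransferThree_of_shaAn_unit_anyImage` — **… and Miller's `BSD(E,3)` at a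
  pair with `ord₃ #Ш(E/ℚ)_an = 0`.**

Every binder is a PUBLISHED named fact (Kato 17.4, Perrin-Riou–Schneider / Perrin-Riou 1987 / Mazur–Tate
σ at odd `p`, modularity, GZK, the period unit `h3`), the ONE open node `KatoMuTransferThree`, or a finite
per-pair certificate (`hcertA`, `hSch`, `hunit`); no rational main conjecture, no flag, no image
hypothesis. With `MuTransferThreeIntModel` §1 (rank `0`) this covers ALL of class X10 flag-free: the
Euler-system half in both ranks, (X_A3 ⟺ `BSD(E,3)`) at rank `0`, `BSD(E,3)` at the `3 ∤ #Ш_an` rank-`1`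
pairs. Where `3` enters: `ClassX10` and the prime of `KatoMuTransferThree`.

References: [Kato2004Asterisque] Thm. 17.4 (2), (3) (p. 273); [Wuthrich2014] Lemma 20, Prop. 21;
[PerrinRiou1987] §1.4 Cor. 1.8; [BalakrishnanMullerStein2015] Thm. 1.7; [GreenbergVatsal2000] (1)–(2),
Prop. 3.7; [Miller2011LMS] Def. 1.1; cell files X10-AUDIT.md §12, §40, §41.
-/

set_option autoImplicit false

noncomputable section

open scoped Classical MatrixGroups ModularForm

open CongruenceSubgroup WeierstrassCurve Literature.NumberTheory.EllipticCurves
  Literature.NumberTheory.EllipticCurves.ModularForms Literature.NumberTheory.EllipticCurves.Rank1Residual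
  Literature.NumberTheory.EllipticCurves.Rank1Residual.Typed
  Literature.NumberTheory.EllipticCurves.Wuthrich2014
  Summit.BirchSwinnertonDyer.BirchSwinnertonDyer.Theorems.Rank1ResidualX1Defs
  Summit.BirchSwinnertonDyer.BirchSwinnertonDyer.Rank1Residual

namespace Summit.BirchSwinnertonDyer.Rank1Residual.X10

variable (W : WeierstrassCurve ℚ) [W.IsElliptic] [W.IsGloballyMinimal]

/-- **Class X10, any rank, EITHER image: Kato ∧ `KatoMuTransferThree` ∧ certificate ⟹ the
Néron-normalised INTEGRAL divisibility datum at `(E,3)`** (the hypothesis `hdiv` of x10 GEN 6's rank-one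
engine), for every cyclotomic datum, the newform of level `N_E`, its period ratio `ϖ` and every dual datum.
Surjective `ρ̄_{E,3}`: Kato 17.4 (3) on the tower (`X10.towerSurj_of_surj`,
`divisibility_of_kato_of_surjective_pow`); otherwise Kato 17.4 (2) + the transfer's `μ = 0` (GEN 34's
`divisibility_of_kato_of_mu_eq_zero`). `ϖ ≠ 0` as `Ω⁺_f > 0`; `ord₃ ϖ = 0` from `h3`.
[cite: Kato2004Asterisque, Thm. 17.4 (2), (3) (p. 273)] [cite: Wuthrich2014, Lemma 20 (p. 399)]
[cite: GreenbergVatsal2000, p. 2 (1)–(2), Prop. (3.7) and §3 Remark (3.4)] -/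
theorem divisibility_three_of_katoMuTransferThree_anyImage
    (hmodP : nonempty_modularParametrizationData) (h3 : realPeriodRat_eq_unit_mul_plusPeriod_three)
    (hT3 : KatoMuTransferThree)
    (hK : ∀ (κ : ZpExtension ℚ 3) (γ : Field.absoluteGaloisGroup ℚ) [NeZero (W.conductorNorm ℤ)]
      (f : CuspForm (Gamma0 (W.conductorNorm ℤ)) 2), kato_divisibility W 3 (κ := κ) (γ := γ) (f := f))
    (hX : ClassX10 W 3)
    (hcertA : ∀ {N : ℕ} [NeZero N] (f : CuspForm (Gamma0 N) 2), IsNewformOf W f →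
      ∃ n : ℕ, ‖PowerSeries.coeff n (padicLFunction f (unitRoot W 3 : ℚ_[3]))‖ = 1) :
    ∀ (κ : ZpExtension ℚ 3) (γ : Field.absoluteGaloisGroup ℚ),
        κ.IsCyclotomic → κ.IsTopGenerator γ → IsCyclotomicVariable 3 γ →
      ∀ [NeZero (W.conductorNorm ℤ)] (f : CuspForm (Gamma0 (W.conductorNorm ℤ)) 2),
        IsNewformOf W f → ∀ (ϖ : ℚ), (ϖ : ℝ) * W.realPeriodRat = plusPeriod f →
      ∀ (D : W.SelmerDualData κ γ), D.IsTorsion ∧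
        ∃ g ∈ D.charIdeal, iwasawaToPowerSeries 3 g =
          PowerSeries.C (ϖ : ℚ_[3]) * padicLFunction f (unitRoot W 3 : ℚ_[3]) := by
  intro κ γ hκ hγ hγ' _ f hf ϖ hϖeq D
  have hplus : plusPeriod f ≠ 0 := (IsNewform0.plusPeriod_pos_holds hf.1 hf.coeffField_eq_bot).ne'
  have hϖ0 : ϖ ≠ 0 := by
    rintro rfl
    apply hplus
    rw [← hϖeq]
    simp
  have hϖv : padicValRat 3 ϖ = 0 :=
    padicValRat_periodRatio_eq_zero_three W h3 hX.2.1.1 hX.2.2.1 f hf ϖ hϖeq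
  by_cases hsurj : Surj W 3
  · exact divisibility_of_kato_of_surjective_pow W 3 (hK κ γ f) (by decide) hX.2.1.1 hX.2.1.2
      (Literature.NumberTheory.EllipticCurves.Rank1Residual.X10.towerSurj_of_surj W hX hsurj) hκ hγ hγ'
      hf D ϖ hϖ0 hϖv
  · have hμ := x10b_mu_eq_zero_of_katoMuTransferThree hmodP hT3 W 3 hX hsurj hcertA
    exact divisibility_of_kato_of_mu_eq_zero W 3 (hK κ γ f) (by decide) hX.2.1.1 hX.2.1.2 hX.2.2.1 hκ
      hγ hγ' hf D (hμ κ γ hκ hγ hγ' D) ϖ hϖ0 hϖv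

/-- **Class X10 ∩ {r = 1}, EITHER image: `KatoMuTransferThree` ∧ certificate ⟹ the Euler-system half
`ord₃ #Ш(E/ℚ) ≤ ord₃ #Ш(E/ℚ)_an`** (`Typed.MissingUpperBoundAt W 3`), modulo the Schneider certificate
`hSch`. PUBLISHED binders `hK` (Kato 17.4), `hS` (BMS Thm. 1.7), `hPR` (Perrin-Riou 1987 §1.4), `hMT`
(Mazur–Tate σ), `hmodP`, `hGZK`, `h3`; CELL input `KatoMuTransferThree`; finite certificates `hcertA`,
`hSch`. No image hypothesis; no rational main conjecture. x10 GEN 6's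
`X10.missingUpperBoundAt_three_rankOne_of_divisibility` fed with the datum above.
[cite: Kato2004Asterisque, Thm. 17.4 (2), (3) (p. 273)] [cite: PerrinRiou1987, §1.4 Cor. 1.8]
[cite: BalakrishnanMullerStein2015, Thm. 1.7] [cite: Miller2011LMS, Def. 1.1 (arXiv:1010.2431 p. 3)] -/
theorem missingUpperBoundAt_three_rankOne_of_katoMuTransferThree_anyImage
    (hS : Schneider1985_order_charGenerator_odd) (hPR : perrinRiou_rankOne_leadingTerms_odd)
    (hMT : mazur_tate_sigma_exists_odd) (hmodP : nonempty_modularParametrizationData)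
    (hGZK : rank_eq_analyticRank_of_analyticRank_le_one)
    (h3 : realPeriodRat_eq_unit_mul_plusPeriod_three) (hT3 : KatoMuTransferThree)
    (hK : ∀ (κ : ZpExtension ℚ 3) (γ : Field.absoluteGaloisGroup ℚ) [NeZero (W.conductorNorm ℤ)]
      (f : CuspForm (Gamma0 (W.conductorNorm ℤ)) 2), kato_divisibility W 3 (κ := κ) (γ := γ) (f := f))
    (hX : ClassX10 W 3) (hr1 : W.analyticRank = 1)
    (hSch : ∀ Dh : PAdicHeightData W 3, Dh.IsCanonical → SchneiderConjecture Dh)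
    (hcertA : ∀ {N : ℕ} [NeZero N] (f : CuspForm (Gamma0 N) 2), IsNewformOf W f →
      ∃ n : ℕ, ‖PowerSeries.coeff n (padicLFunction f (unitRoot W 3 : ℚ_[3]))‖ = 1) :
    Typed.MissingUpperBoundAt W 3 :=
  Summit.BirchSwinnertonDyer.BirchSwinnertonDyer.Theorems.Rank1ResidualX10bMainConjecture.X10.missingUpperBoundAt_three_rankOne_of_divisibility
    W hS hPR hMT hmodP hGZK hX hr1 hSch
    (divisibility_three_of_katoMuTransferThree_anyImage W hmodP h3 hT3 hK hX hcertA)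

/-- **Class X10 ∩ {r = 1}, EITHER image, at a pair with `ord₃ #Ш(E/ℚ)_an = 0`: `KatoMuTransferThree` ∧
certificates ⟹ Miller's `BSD(E,3)`.** The lower half is vacuous (`hunit`), the upper half is the
theorem above. Every binder is a PUBLISHED named fact, the open node, or a finite per-pair certificate
(`hcertA`, `hSch`, `hunit`); no image hypothesis, no flag. Per pair; nothing booked.
[cite: Kato2004Asterisque, Thm. 17.4 (2), (3) (p. 273)] [cite: PerrinRiou1987, §1.4 Cor. 1.8]
[cite: BalakrishnanMullerStein2015, Thm. 1.7] [cite: Miller2011LMS, Def. 1.1 (arXiv:1010.2431 p. 3)] -/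
theorem bsdp_three_rankOne_of_katoMuTransferThree_of_shaAn_unit_anyImage
    (hS : Schneider1985_order_charGenerator_odd) (hPR : perrinRiou_rankOne_leadingTerms_odd)
    (hMT : mazur_tate_sigma_exists_odd) (hmodP : nonempty_modularParametrizationData)
    (hGZK : rank_eq_analyticRank_of_analyticRank_le_one)
    (h3 : realPeriodRat_eq_unit_mul_plusPeriod_three) (hT3 : KatoMuTransferThree)
    (hK : ∀ (κ : ZpExtension ℚ 3) (γ : Field.absoluteGaloisGroup ℚ) [NeZero (W.conductorNorm ℤ)]
      (f : CuspForm (Gamma0 (W.conductorNorm ℤ)) 2), kato_divisibility W 3 (κ := κ) (γ := γ) (f := f))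
    (hX : ClassX10 W 3) (hr1 : W.analyticRank = 1)
    (hSch : ∀ Dh : PAdicHeightData W 3, Dh.IsCanonical → SchneiderConjecture Dh)
    (hcertA : ∀ {N : ℕ} [NeZero N] (f : CuspForm (Gamma0 N) 2), IsNewformOf W f →
      ∃ n : ℕ, ‖PowerSeries.coeff n (padicLFunction f (unitRoot W 3 : ℚ_[3]))‖ = 1)
    (hunit : ∃ q : ℚ, shaAn W = (q : ℂ) ∧ padicValRat 3 q = 0) : BSDp W 3 :=
  Summit.BirchSwinnertonDyer.BirchSwinnertonDyer.Theorems.Rank1ResidualX10bMainConjecture.X10.bsdp_three_rankOne_of_divisibility_of_shaAn_unit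
    W hS hPR hMT hmodP hGZK hX hr1 hSch
    (divisibility_three_of_katoMuTransferThree_anyImage W hmodP h3 hT3 hK hX hcertA) hunit

end Summit.BirchSwinnertonDyer.Rank1Residual.X10

end
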